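import Literature.AlgebraicGeometry.HodgeTheory.NonCMEllipticCurvePowersHodgeClasses
import Mathlib.LinearAlgebra.Matrix.Basis
import Mathlib.LinearAlgebra.Determinant
import HarnessLib

/-!
# The Hodge conjecture for the powers of an ARBITRARY complex elliptic curve (Tate; Murasaki; van Geemen 1994 Thm. 4.3; Moonen–Zarhin 1999 (2.1) and Cor. 3.9)

Family `hodge`, layer `Literature/AlgebraicGeometry/HodgeTheory`. Research context of the cell
`pub-hodge-ring2` (atlas rows `g = 1`): a route conditional on HC_CM; this file is UNCONDITIONAL Hodge
theory and is not a step towards a summit statement. It MERGES the two published cases already in the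
tree —

* `EllipticCurve.hodgeConjectureFor_powSucc_of_cm` (file `MaximalPicardNumberHodgeClasses`): `E` with a
  complex multiplication `φ : E → E`, `φ² = -d` (`d ≥ 1`) — Murasaki, Moonen–Zarhin Type IV(1,1);
* `EllipticCurve.hodgeConjectureFor_powSucc_of_hodgeEndTrivial` (file
  `NonCMEllipticCurvePowersHodgeClasses`): `E` whose rational Hodge structure `H¹(E)` has only scalar
  endomorphisms — Tate, Moonen–Zarhin Type I(1) —

into ONE unconditional theorem for every complex elliptic curve,

  **`EllipticCurve.hodgeConjectureFor_powSucc : E.dim = 1 → ∀ N, HodgeConjectureFor (Eᴺ⁺¹).dim (Eᴺ⁺¹).X`**,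

together with `Bᵖ(Eᴺ⁺¹) ⊆ Dᵖ(Eᴺ⁺¹) ⊗ ℂ` (`EllipticCurve.hodgeClasses_divisorial_powSucc`), the same for every
abelian variety with an `E`-slot structure (`EllSlots.hodgeConjectureFor'`: all products of copies of `E` in
any bracketing) and for every abelian variety isogenous to one of these
(`EllipticCurve.hodgeConjectureFor_of_isIsogenous_powSucc`). PUBLISHED STATEMENTS: van Geemen, LNM 1594,
Thm. 4.3 "(Tate) For an abelian variety `X` which is isogeneous to a product of elliptic curves […]
`Bᵖ(X) = Dᵖ(X)` for all `p`, and thus the Hodge `(p, p)`-conjecture is true for `X` and all `p`" — here in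
the case of ONE curve (the isotypic case; several pairwise non-isogenous curves, Imai / Moonen–Zarhin
Cor. 3.9 in full, are not treated); Gordon §3: "In [B.80] Murasaki showed the `Hdgᵖ(Eⁿ) = Divᵖ(Eⁿ)` for
all `p`" (no hypothesis on `E`); Moonen–Zarhin (2.1): "`g = 1`. There are two cases to distinguish.
Type I(1): `X` is an elliptic curve with `End⁰(X) = ℚ`. Then `Hg(X) = Sp(V, φ) ≅ SL_{2,ℚ}`. Type IV(1,1):
`X` is an elliptic curve with CM by an imaginary quadratic field `F`. Then `Hg(X) = U_F`", and Cor. 3.9: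
"every product of elliptic curves satisfies condition (D)" (`𝒟•(Xⁿ) = ℬ•(Xⁿ)` for all `n`, (1.8)).

## The mechanism (no Hodge group, no endomorphism of `E` is constructed)

The dichotomy is taken HODGE-THEORETICALLY (`EllipticCurve.exists_hodgeEnd_of_not_hodgeEndTrivial`):
either `E` is `HodgeEndTrivial` (every `ℂ`-linear endomorphism of `H¹(E(ℂ); ℂ)` preserving rational classes
and the types `(1,0)`, `(0,1)` is scalar) — then `NonCMEllipticCurvePowersHodgeClasses` applies —, or there
is such an endomorphism `T` with `T ω = λ ω`, `T ω̄ = μ ω̄` and `λ ≠ μ` (`ω` a generator of `H^{1,0}(E)`).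
In the second case the two CROSS CLASSES `pr₁^*ω ⌣ pr₂^*ω̄`, `pr₁^*ω̄ ⌣ pr₂^*ω ∈ H²((E × E)(ℂ); ℂ)` lie in
`D¹(E × E) ⊗ ℂ`, the `ℂ`-span of the rational `(1,1)`-classes
(`EllipticCurve.cross_mem_span_rational_oneOne_of_not_hodgeEndTrivial`): for a rational basis `e₀, e₁`
of `H¹(E)` the two classes `pr₁^*e₀ ⌣ pr₂^*e₁ - pr₁^*e₁ ⌣ pr₂^*e₀` and
`pr₁^*e₀ ⌣ pr₂^*(T e₁) - pr₁^*e₁ ⌣ pr₂^*(T e₀)` are rational, and by the alternating-pair identity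
(`bilin_alt_pair`) they equal `δ (e₁₂ - e₂₁)` and `δ (μ e₁₂ - λ e₂₁)` with `δ = det ≠ 0` the determinant
of the change of basis to `(ω, ω̄)` — so they are also of type `(1,1)`, and `λ ≠ μ` separates `e₁₂`,
`e₂₁`. This cross class is the ONLY input of the CM mechanism of `MaximalPicardNumberHodgeClasses`
(Gordon §3 after Murty: every `(1,1)`-class of a product of copies of `E` is a combination of
`g^*ω ⌣ h^*ω̄ = (g,h)^*(pr₁^*ω ⌣ pr₂^*ω̄)`), restated here with the cross class as a HYPOTHESIS
(`EllipticCurve.oneOne_mem_span_rational_of_cross`), whence `H^{1,1} = D¹ ⊗ ℂ`, `Bᵖ ⊆ Dᵖ ⊗ ℂ`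
(`AbelianVariety.hodgeClasses_divisorial_of_oneOne`) and the Hodge conjecture
(`AbelianVariety.hodgeConjectureFor_of_oneOne`). Slot structures satisfy the generation hypothesis
(`EllSlots.hodgeOneZero_mem_span_pullback`), which joins the two branches on the same carriers.

Everything below is proved; no definition and no named fact is introduced (D-0026); axioms `propext`,
`Classical.choice`, `Quot.sound` only.

HONEST SCOPE: one elliptic curve `E` (any), all its powers `E.powSucc N`, everything with an `EllSlots`
structure, and their isogeny classes (van Geemen Lemma 3.7 = the tree's `HodgeConjectureFor.of_isIsogenous`).
Products of SEVERAL pairwise non-isogenous curves (Imai; Moonen–Zarhin Cor. 3.9 in full) are not treated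
here; two CM curves with different CM fields are `HodgeClassesTwoCMCurvesProducts`. The equivalence of
`HodgeEndTrivial E` with `End(E) = ℤ` (Riemann's theorem / Lefschetz `(1,1)` on `E × E`) is not used and
not proved here.

## References

* [vanGeemen1994HodgeAV] B. van Geemen, An introduction to the Hodge conjecture for abelian varieties,
  LNM 1594 (1994), Thm. 4.3, Lemma 3.7, §2.4–2.5.
* [Gordon1997] B. B. Gordon, A survey of the Hodge conjecture for abelian varieties,
  arXiv:alg-geom/9709030 = App. B of Lewis, CRM Monogr. Ser. 10 (1999), §3 (Tate; Murasaki [B.80]).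
* [MoonenZarhin1999LowDim] B. Moonen, Yu. Zarhin, Hodge classes on abelian varieties of low dimension,
  Math. Ann. 315 (1999) 711–733, (2.1) (`g = 1`: Types I(1), IV(1,1)), (1.8), Cor. 3.9.
* [LangeBirkenhake1992] H. Lange, Ch. Birkenhake, Complex Abelian Varieties (1992), §1.2, Lemma 1.1.17,
  Thm. 4.2.1, §5 (Néron–Severi of `E × E`).
* [VoisinHodgeI2002] C. Voisin, Hodge Theory and Complex Algebraic Geometry I (2002), §6.1.3, §7.1.1,
  §7.3.2, §11.3.
* [HatcherAT2002] A. Hatcher, Algebraic Topology (2002), §3.1, §3.2.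
* [Deligne2000] P. Deligne, The Hodge conjecture (Clay problem description, 2000), §1.
-/

noncomputable section

open CategoryTheory
open Literature.AlgebraicTopology.SingularHomology
open Literature.AlgebraicGeometry.Motives (IsSmoothProjective AbelianVariety)
open Literature.Barriers.HodgeConjecture
open Literature.NumberTheory.DiophantineGeometry

namespace Literature.AlgebraicGeometry.HodgeTheory

section HodgeTheory

/-! ### §0 Two pieces of linear algebra -/

section LinearAlgebra

/-- **The alternating-pair identity** for a bilinear map `Φ` and two vectors written in a pair `x, y`:
`Φ(c x + d y, c' x + d' y) - Φ(c' x + d' y, c x + d y) = (c d' - d c') · (Φ(x,y) - Φ(y,x))` (the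
antisymmetrisation of `V ⊗ V` factors through `⋀² V`, a line when `dim V = 2`). [folklore] -/
private theorem bilin_alt_pair {V W : Type*} [AddCommGroup V] [Module ℂ V] [AddCommGroup W] [Module ℂ W]
    (Φ : V →ₗ[ℂ] V →ₗ[ℂ] W) (x y : V) (c d c' d' : ℂ) :
    Φ (c • x + d • y) (c' • x + d' • y) - Φ (c' • x + d' • y) (c • x + d • y) =
      (c * d' - d * c') • (Φ x y - Φ y x) := by
  simp only [map_add, map_smul, LinearMap.add_apply, LinearMap.smul_apply]
  module

/-- Rational classes are closed under subtraction (`a - b = a + (-1) • b`, `-1 ∈ ℚ`).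
[cite: HatcherAT2002, §3.1] -/
theorem IsRationalClass.sub {Y : Type} [TopologicalSpace Y] {k : ℕ} {a b : singularCohomology ℂ ℂ Y k}
    (ha : IsRationalClass a) (hb : IsRationalClass b) : IsRationalClass (a - b) := by
  have h := ha.add (hb.smul (-1 : ℚ))
  rwa [Rat.cast_neg, Rat.cast_one, neg_one_smul, ← sub_eq_add_neg] at h

end LinearAlgebra

/-! ### §1 The Hodge-theoretic dichotomy for an elliptic curve: scalar endomorphisms only, or two eigenvalues -/

section Dichotomy

variable {E : AbelianVariety ℂ}

/-- **Moonen–Zarhin (2.1), `g = 1`, Hodge-theoretically: an elliptic curve is of Type I(1) or of Type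
IV(1,1).** If NOT every endomorphism of the rational Hodge structure `H¹(E)` is a scalar
(`¬ EllipticCurve.HodgeEndTrivial E`), then there is a `ℂ`-linear endomorphism `T` of `H¹(E(ℂ); ℂ)` mapping
rational classes to rational classes with `T ω = λ ω`, `T ω̄ = μ ω̄` and `λ ≠ μ`, where `ω` generates
`H^{1,0}(E) = ℂ ω` and `ω̄` is its conjugate (a type-preserving `T` is diagonal in the Hodge basis
`(ω, ω̄)`; equal eigenvalues would make it scalar). "Type I(1): `X` is an elliptic curve with
`End⁰(X) = ℚ` […] Type IV(1,1): `X` is an elliptic curve with CM by an imaginary quadratic field `F`."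
[cite: MoonenZarhin1999LowDim, (2.1) (g = 1)] [cite: LangeBirkenhake1992, Lemma 1.1.17 and Thm. 4.2.1] -/
theorem EllipticCurve.exists_hodgeEnd_of_not_hodgeEndTrivial (hE : E.dim = 1)
    (hT : ¬ EllipticCurve.HodgeEndTrivial E) {ω : complexBetti E.X 1}
    (hω : IsOfHodgeType E.dim E.X 1 1 0 ω) (hω0 : ω ≠ 0)
    (hgen : ∀ u : complexBetti E.X 1, IsOfHodgeType E.dim E.X 1 1 0 u → ∃ c : ℂ, u = c • ω) :
    ∃ (T : complexBetti E.X 1 →ₗ[ℂ] complexBetti E.X 1) (lam mu : ℂ),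
      (∀ x, IsRationalClass x → IsRationalClass (T x)) ∧ T ω = lam • ω ∧
        T (conjClass (Motives.ComplexPoints E.X) 1 ω) = mu • conjClass (Motives.ComplexPoints E.X) 1 ω ∧
          lam ≠ mu := by
  have hX : IsSmoothProjective E.dim E.X := Motives.AbelianVariety.isSmoothProjective_holds
  unfold EllipticCurve.HodgeEndTrivial at hT
  push Not at hT
  obtain ⟨T, hrat, h10, h01, hne⟩ := hT
  set ω' := conjClass (Motives.ComplexPoints E.X) 1 ω with hω'
  have hω't : IsOfHodgeType E.dim E.X 1 0 1 ω' := hω.conjClass hX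
  obtain ⟨lam, hlam⟩ := hgen (T ω) (h10 ω hω)
  obtain ⟨mu, hmu⟩ := EllipticCurve.exists_eq_smul_conj hgen (T ω') (h01 ω' hω't)
  refine ⟨T, lam, mu, hrat, hlam, hmu, fun heq ↦ ?_⟩
  -- `(ω, ω̄)` is a basis of `H¹(E)`; `T` acts on it by `lam = mu`, so `T = lam • id`
  haveI := finite_complexBetti_abelianVariety E 1
  have h2 : Module.finrank ℂ (complexBetti E.X 1) = 2 := by
    rw [Motives.AbelianVariety.finrank_complexBetti_one, hE]
  have hω'0 : ω' ≠ 0 := fun h ↦ hω0 (by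
    rw [← conjClass_conjClass ω, ← hω', h, conjClass_zero])
  have hli : LinearIndependent ℂ ![ω, ω'] := by
    rw [LinearIndependent.pair_iff' hω0]
    intro a ha
    have h10' : IsOfHodgeType E.dim E.X 1 1 0 ω' := by rw [← ha]; exact hω.smul a
    exact hω'0 (eq_zero_of_isOfHodgeType_one_zero_of_zero_one hX h10' hω't)
  let f : Module.Basis (Fin 2) ℂ (complexBetti E.X 1) :=
    basisOfLinearIndependentOfCardEqFinrank hli (by rw [h2]; simp)
  have hf0 : f 0 = ω := by
    simp only [f, coe_basisOfLinearIndependentOfCardEqFinrank, Matrix.cons_val_zero]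
  have hf1 : f 1 = ω' := by
    simp only [f, coe_basisOfLinearIndependentOfCardEqFinrank, Matrix.cons_val_one, Matrix.cons_val_zero]
  refine hne lam (f.ext fun i ↦ ?_)
  fin_cases i
  · change T (f 0) = (lam • LinearMap.id : complexBetti E.X 1 →ₗ[ℂ] complexBetti E.X 1) (f 0)
    rw [hf0, LinearMap.smul_apply, LinearMap.id_apply, hlam]
  · change T (f 1) = (lam • LinearMap.id : complexBetti E.X 1 →ₗ[ℂ] complexBetti E.X 1) (f 1)
    rw [hf1, LinearMap.smul_apply, LinearMap.id_apply, hmu, heq]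

/-- **The `E × E` cross classes are divisorial as soon as `H¹(E)` has a non-scalar Hodge endomorphism**
(the Hodge-theoretic form of Murasaki's basis of `Hdg¹(E²)`, `rk NS(E × E) = 4` in the CM case): with
`ω` a generator of `H^{1,0}(E)` and `ω̄` its conjugate, if `¬ EllipticCurve.HodgeEndTrivial E` then
`pr₁^*ω ⌣ pr₂^*ω̄` and `pr₁^*ω̄ ⌣ pr₂^*ω` lie in `D¹(E × E) ⊗ ℂ`, the `ℂ`-span of the rational
`(1,1)`-classes of `H²((E × E)(ℂ); ℂ)`. Proof: for a rational basis `e₀, e₁` of `H¹(E)` and the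
endomorphism `T` of `EllipticCurve.exists_hodgeEnd_of_not_hodgeEndTrivial` (`T ω = λ ω`, `T ω̄ = μ ω̄`,
`λ ≠ μ`), the rational classes `pr₁^*e₀ ⌣ pr₂^*e₁ - pr₁^*e₁ ⌣ pr₂^*e₀` and
`pr₁^*e₀ ⌣ pr₂^*(T e₁) - pr₁^*e₁ ⌣ pr₂^*(T e₀)` equal `δ (e₁₂ - e₂₁)` and `δ (μ e₁₂ - λ e₂₁)`, `δ ≠ 0` the
determinant of the change of basis (`bilin_alt_pair`), hence are of type `(1,1)`; `λ ≠ μ` separates. Same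
conclusion as `EllipticCurve.cm_cross_mem_span_rational_oneOne`, without an endomorphism of `E`.
[cite: Gordon1997, §3 (Murasaki [B.80]; proof of the Theorem, CM case)]
[cite: LangeBirkenhake1992, §5 (Néron–Severi of `E × E`) and Thm. 4.2.1]
[cite: MoonenZarhin1999LowDim, (2.1) (g = 1)] -/
theorem EllipticCurve.cross_mem_span_rational_oneOne_of_not_hodgeEndTrivial (hE : E.dim = 1)
    (hT : ¬ EllipticCurve.HodgeEndTrivial E) {ω : complexBetti E.X 1}
    (hω : IsOfHodgeType E.dim E.X 1 1 0 ω) (hω0 : ω ≠ 0)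
    (hgen : ∀ u : complexBetti E.X 1, IsOfHodgeType E.dim E.X 1 1 0 u → ∃ c : ℂ, u = c • ω) :
    cupProduct (show 1 + 1 = 2 by norm_num)
        (complexBetti.map (Motives.AbelianVariety.fst E E).hom.hom.hom 1 ω)
        (complexBetti.map (Motives.AbelianVariety.snd E E).hom.hom.hom 1
          (conjClass (Motives.ComplexPoints E.X) 1 ω)) ∈
      Submodule.span ℂ {b : complexBetti (E.prod E).X 2 |
        IsRationalClass b ∧ IsOfHodgeType (E.prod E).dim (E.prod E).X 2 1 1 b} ∧
    cupProduct (show 1 + 1 = 2 by norm_num)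
        (complexBetti.map (Motives.AbelianVariety.fst E E).hom.hom.hom 1
          (conjClass (Motives.ComplexPoints E.X) 1 ω))
        (complexBetti.map (Motives.AbelianVariety.snd E E).hom.hom.hom 1 ω) ∈
      Submodule.span ℂ {b : complexBetti (E.prod E).X 2 |
        IsRationalClass b ∧ IsOfHodgeType (E.prod E).dim (E.prod E).X 2 1 1 b} := by
  have hX : IsSmoothProjective E.dim E.X := Motives.AbelianVariety.isSmoothProjective_holds
  have hXX : IsSmoothProjective (E.prod E).dim (E.prod E).X :=
    Motives.AbelianVariety.isSmoothProjective_holds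
  have h11 : (1 : ℕ) + 1 = 2 := by norm_num
  have hcup : CupPreservesHodgeType (E.prod E).dim (E.prod E).X :=
    cupPreservesHodgeType_of_multiplicative_deRham
      (fun F _ _ _ ↦ Literature.NumberTheory.Transcendental.exists_deRhamIsoFamily_holds F) hXX
  obtain ⟨T, lam, mu, hTrat, hlam, hmu, hne⟩ :=
    EllipticCurve.exists_hodgeEnd_of_not_hodgeEndTrivial hE hT hω hω0 hgen
  set ω' := conjClass (Motives.ComplexPoints E.X) 1 ω with hω'
  set R := Submodule.span ℂ {b : complexBetti (E.prod E).X 2 |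
    IsRationalClass b ∧ IsOfHodgeType (E.prod E).dim (E.prod E).X 2 1 1 b} with hR
  set P := (complexBetti.map (Motives.AbelianVariety.fst E E).hom.hom.hom 1).hom with hP
  set Q := (complexBetti.map (Motives.AbelianVariety.snd E E).hom.hom.hom 1).hom with hQ
  -- Hodge types of the letters and of the two cross classes
  have hω't : IsOfHodgeType E.dim E.X 1 0 1 ω' := hω.conjClass hX
  have hPω : IsOfHodgeType (E.prod E).dim (E.prod E).X 1 1 0 (P ω) := hω.map_of_isSmoothProjective hXX hX _
  have hQω : IsOfHodgeType (E.prod E).dim (E.prod E).X 1 1 0 (Q ω) := hω.map_of_isSmoothProjective hXX hX _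
  have hPω' : IsOfHodgeType (E.prod E).dim (E.prod E).X 1 0 1 (P ω') :=
    hω't.map_of_isSmoothProjective hXX hX _
  have hQω' : IsOfHodgeType (E.prod E).dim (E.prod E).X 1 0 1 (Q ω') :=
    hω't.map_of_isSmoothProjective hXX hX _
  set e12 := cupProduct h11 (P ω) (Q ω') with he12
  set e21 := cupProduct h11 (P ω') (Q ω) with he21
  have he12t : IsOfHodgeType (E.prod E).dim (E.prod E).X 2 1 1 e12 := by
    simpa only [Nat.add_zero, Nat.zero_add] using hcup h11 hPω hQω'
  have he21t : IsOfHodgeType (E.prod E).dim (E.prod E).X 2 1 1 e21 := by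
    simpa only [Nat.add_zero, Nat.zero_add] using hcup h11 hPω' hQω
  -- a rational basis `e` and the Hodge basis `f = (ω, ω̄)`
  obtain ⟨e, he⟩ := EllipticCurve.exists_rational_basis hE
  haveI := finite_complexBetti_abelianVariety E 1
  have h2 : Module.finrank ℂ (complexBetti E.X 1) = 2 := by
    rw [Motives.AbelianVariety.finrank_complexBetti_one, hE]
  have hω'0 : ω' ≠ 0 := fun h ↦ hω0 (by
    rw [← conjClass_conjClass ω, ← hω', h, conjClass_zero])
  have hli : LinearIndependent ℂ ![ω, ω'] := by
    rw [LinearIndependent.pair_iff' hω0]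
    intro a ha
    have h10' : IsOfHodgeType E.dim E.X 1 1 0 ω' := by rw [← ha]; exact hω.smul a
    exact hω'0 (eq_zero_of_isOfHodgeType_one_zero_of_zero_one hX h10' hω't)
  let f : Module.Basis (Fin 2) ℂ (complexBetti E.X 1) :=
    basisOfLinearIndependentOfCardEqFinrank hli (by rw [h2]; simp)
  have hf0 : f 0 = ω := by
    simp only [f, coe_basisOfLinearIndependentOfCardEqFinrank, Matrix.cons_val_zero]
  have hf1 : f 1 = ω' := by
    simp only [f, coe_basisOfLinearIndependentOfCardEqFinrank, Matrix.cons_val_one, Matrix.cons_val_zero]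
  -- coordinates `e ℓ = c ℓ • ω + d ℓ • ω̄` and the determinant `δ = c₀ d₁ - d₀ c₁ ≠ 0`
  set c : Fin 2 → ℂ := fun ℓ ↦ f.repr (e ℓ) 0 with hc
  set d : Fin 2 → ℂ := fun ℓ ↦ f.repr (e ℓ) 1 with hd
  have hexp : ∀ ℓ, e ℓ = c ℓ • ω + d ℓ • ω' := by
    intro ℓ
    have h := f.sum_repr (e ℓ)
    rw [Fin.sum_univ_two, hf0, hf1] at h
    exact h.symm
  have hδ : c 0 * d 1 - d 0 * c 1 ≠ 0 := by
    have hu := (f.isUnit_det e).ne_zero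
    rw [Module.Basis.det_apply, Matrix.det_fin_two] at hu
    simp only [Module.Basis.toMatrix_apply] at hu
    convert hu using 1
    simp only [hc, hd]
    ring
  -- for a rational-class-preserving `S` with `S ω = a ω`, `S ω̄ = b ω̄`: `δ (b e₁₂ - a e₂₁) ∈ R`
  have key : ∀ (S : complexBetti E.X 1 →ₗ[ℂ] complexBetti E.X 1),
      (∀ x, IsRationalClass x → IsRationalClass (S x)) → ∀ a b : ℂ, S ω = a • ω → S ω' = b • ω' →
        (c 0 * d 1 - d 0 * c 1) • (b • e12 - a • e21) ∈ R := by
    intro S hS a b hSa hSb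
    let Φ : complexBetti E.X 1 →ₗ[ℂ] complexBetti E.X 1 →ₗ[ℂ] complexBetti (E.prod E).X 2 :=
      (cupProduct h11).compl₁₂ P (Q ∘ₗ S)
    have hΦ : ∀ x y, Φ x y = cupProduct h11 (P x) (Q (S y)) := fun x y ↦ rfl
    -- the rational class `r = pr₁^*e₀ ⌣ pr₂^*(S e₁) - pr₁^*e₁ ⌣ pr₂^*(S e₀)`
    have hrat : IsRationalClass (Φ (e 0) (e 1) - Φ (e 1) (e 0)) := by
      rw [hΦ, hΦ]
      exact (((he 0).map _).cup h11 ((hS _ (he 1)).map _)).sub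
        (((he 1).map _).cup h11 ((hS _ (he 0)).map _))
    -- `r = δ (b e₁₂ - a e₂₁)`
    have hid : Φ (e 0) (e 1) - Φ (e 1) (e 0) = (c 0 * d 1 - d 0 * c 1) • (b • e12 - a • e21) := by
      rw [hexp 0, hexp 1, bilin_alt_pair, hΦ, hΦ, hSa, hSb]
      simp only [map_smul, he12, he21]
    -- hence `r` is of type `(1,1)` and lies in `R`
    have htype : IsOfHodgeType (E.prod E).dim (E.prod E).X 2 1 1
        ((c 0 * d 1 - d 0 * c 1) • (b • e12 - a • e21)) :=
      (((he12t.smul b).sub hXX (he21t.smul a))).smul _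
    rw [← hid]
    refine Submodule.subset_span ⟨hrat, ?_⟩
    rw [hid]
    exact htype
  -- `S = id`: `δ (e₁₂ - e₂₁) ∈ R`; `S = T`: `δ (μ e₁₂ - λ e₂₁) ∈ R`
  have hu : e12 - e21 ∈ R := by
    have h := key LinearMap.id (fun x hx ↦ hx) 1 1 (by rw [LinearMap.id_apply, one_smul])
      (by rw [LinearMap.id_apply, one_smul])
    rw [one_smul, one_smul] at h
    exact (Submodule.smul_mem_iff R hδ).1 h
  have hv : mu • e12 - lam • e21 ∈ R :=
    (Submodule.smul_mem_iff R hδ).1 (key T hTrat lam mu hlam hmu)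
  have hsep : mu - lam ≠ 0 := sub_ne_zero.2 (Ne.symm hne)
  have h12 : e12 ∈ R := by
    have h := Submodule.sub_mem _ hv (Submodule.smul_mem _ lam hu)
    have eq : mu • e12 - lam • e21 - lam • (e12 - e21) = (mu - lam) • e12 := by module
    rw [eq] at h
    exact (Submodule.smul_mem_iff _ hsep).1 h
  have h21 : e21 ∈ R := by
    have h := Submodule.sub_mem _ hv (Submodule.smul_mem _ mu hu)
    have eq : mu • e12 - lam • e21 - mu • (e12 - e21) = (mu - lam) • e21 := by module
    rw [eq] at h
    exact (Submodule.smul_mem_iff _ hsep).1 h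
  exact ⟨h12, h21⟩

/-- **The dichotomy assembled on `E × E`**: for EVERY complex elliptic curve, either `E` is
`HodgeEndTrivial` (Type I(1); then `NonCMEllipticCurvePowersHodgeClasses` applies), or the cross class
`pr₁^*ω ⌣ pr₂^*ω̄` lies in `D¹(E × E) ⊗ ℂ` (Type IV(1,1), read Hodge-theoretically). Gordon §3, proof of the
Theorem: "The cases where `E` has or does not have complex multiplication have to be handled separately."
[cite: MoonenZarhin1999LowDim, (2.1) (g = 1)] [cite: Gordon1997, §3 (proof of the Theorem)] -/
theorem EllipticCurve.hodgeEndTrivial_or_cross_mem_span_rational_oneOne (hE : E.dim = 1)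
    {ω : complexBetti E.X 1} (hω : IsOfHodgeType E.dim E.X 1 1 0 ω) (hω0 : ω ≠ 0)
    (hgen : ∀ u : complexBetti E.X 1, IsOfHodgeType E.dim E.X 1 1 0 u → ∃ c : ℂ, u = c • ω) :
    EllipticCurve.HodgeEndTrivial E ∨
      cupProduct (show 1 + 1 = 2 by norm_num)
          (complexBetti.map (Motives.AbelianVariety.fst E E).hom.hom.hom 1 ω)
          (complexBetti.map (Motives.AbelianVariety.snd E E).hom.hom.hom 1
            (conjClass (Motives.ComplexPoints E.X) 1 ω)) ∈
        Submodule.span ℂ {b : complexBetti (E.prod E).X 2 |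
          IsRationalClass b ∧ IsOfHodgeType (E.prod E).dim (E.prod E).X 2 1 1 b} := by
  by_cases hT : EllipticCurve.HodgeEndTrivial E
  · exact Or.inl hT
  · exact Or.inr (EllipticCurve.cross_mem_span_rational_oneOne_of_not_hodgeEndTrivial hE hT hω hω0 hgen).1

end Dichotomy

/-! ### §2 The CM mechanism with the cross class as hypothesis (Gordon §3 after Murty) -/

section Cross

variable {E : AbelianVariety ℂ}

/-- **`H^{1,1}(B) ⊆ D¹(B) ⊗ ℂ` for every complex abelian variety `B` whose `(1,0)`-classes are combinations
of pull-backs of `(1,0)`-classes of ONE elliptic curve `E`, GRANTED the cross class**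
`pr₁^*ω ⌣ pr₂^*ω̄ ∈ D¹(E × E) ⊗ ℂ` (`ω` with `H^{1,0}(E) = ℂ ω`): a `(1,1)`-class is a combination of `u ⌣ v`,
`u ∈ H^{1,0}(B)`, `v ∈ H^{0,1}(B)` (`AbelianVariety.oneOne_mem_span_cupProduct`), hence of
`g^*ω ⌣ h^*ω̄ = (g,h)^*(pr₁^*ω ⌣ pr₂^*ω̄)`, a pull-back of the cross class, and pull-backs preserve
`D¹ ⊗ ℂ` (`map_mem_span_rational_oneOne`). This is the proof of
`EllipticCurve.oneOne_mem_span_rational_of_hodgeOneZero_mem_span_pullback` with its only use of complex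
multiplication turned into a hypothesis. [cite: Gordon1997, §3 (proof of the Theorem, CM case)]
[cite: vanGeemen1994HodgeAV, Thm. 4.3] -/
theorem EllipticCurve.oneOne_mem_span_rational_of_cross {ω : complexBetti E.X 1}
    (hgen : ∀ u : complexBetti E.X 1, IsOfHodgeType E.dim E.X 1 1 0 u → ∃ c : ℂ, u = c • ω)
    (hcross : cupProduct (show 1 + 1 = 2 by norm_num)
        (complexBetti.map (Motives.AbelianVariety.fst E E).hom.hom.hom 1 ω)
        (complexBetti.map (Motives.AbelianVariety.snd E E).hom.hom.hom 1
          (conjClass (Motives.ComplexPoints E.X) 1 ω)) ∈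
      Submodule.span ℂ {b : complexBetti (E.prod E).X 2 |
        IsRationalClass b ∧ IsOfHodgeType (E.prod E).dim (E.prod E).X 2 1 1 b})
    (B : AbelianVariety ℂ)
    (hB : ∀ u : complexBetti B.X 1, IsOfHodgeType B.dim B.X 1 1 0 u →
      u ∈ Submodule.span ℂ {y : complexBetti B.X 1 | ∃ (g : B ⟶ E) (w : complexBetti E.X 1),
        IsOfHodgeType E.dim E.X 1 1 0 w ∧ y = complexBetti.map g.hom.hom.hom 1 w})
    (b : complexBetti B.X 2) (hb : IsOfHodgeType B.dim B.X 2 1 1 b) :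
    b ∈ Submodule.span ℂ {b : complexBetti B.X 2 | IsRationalClass b ∧ IsOfHodgeType B.dim B.X 2 1 1 b} := by
  have h11 : (1 : ℕ) + 1 = 2 := by norm_num
  have hBs : IsSmoothProjective B.dim B.X := Motives.AbelianVariety.isSmoothProjective_holds
  have hEEs : IsSmoothProjective (E.prod E).dim (E.prod E).X := Motives.AbelianVariety.isSmoothProjective_holds
  set ω' := conjClass (Motives.ComplexPoints E.X) 1 ω with hω'
  set R := Submodule.span ℂ {b : complexBetti B.X 2 | IsRationalClass b ∧ IsOfHodgeType B.dim B.X 2 1 1 b}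
    with hR
  -- `g^*ω ⌣ h^*ω̄ = (g,h)^*(pr₁^*ω ⌣ pr₂^*ω̄) ∈ R`
  have hpair : ∀ g h : B ⟶ E,
      cupProduct h11 (complexBetti.map g.hom.hom.hom 1 ω) (complexBetti.map h.hom.hom.hom 1 ω') ∈ R := by
    intro g h
    have hgh := map_mem_span_rational_oneOne hBs hEEs (Motives.AbelianVariety.prodLift g h).hom.hom.hom hcross
    rw [complexBetti.map_cupProduct, complexBetti_map_map_hom, complexBetti_map_map_hom,
      Motives.AbelianVariety.prodLift_fst, Motives.AbelianVariety.prodLift_snd] at hgh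
    exact hgh
  -- bilinear extension to the spans
  have hle : Submodule.map₂ (cupProduct h11)
      (Submodule.span ℂ {y : complexBetti B.X 1 | ∃ (g : B ⟶ E) (w : complexBetti E.X 1),
        IsOfHodgeType E.dim E.X 1 1 0 w ∧ y = complexBetti.map g.hom.hom.hom 1 w})
      (Submodule.span ℂ {y : complexBetti B.X 1 | ∃ (g : B ⟶ E) (w : complexBetti E.X 1),
        IsOfHodgeType E.dim E.X 1 0 1 w ∧ y = complexBetti.map g.hom.hom.hom 1 w}) ≤ R := by
    rw [Submodule.map₂_span_span, Submodule.span_le]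
    rintro _ ⟨_, ⟨g, w, hw, rfl⟩, _, ⟨h, w', hw', rfl⟩, rfl⟩
    obtain ⟨c, rfl⟩ := hgen w hw
    obtain ⟨c', rfl⟩ := EllipticCurve.exists_eq_smul_conj hgen w' hw'
    change cupProduct h11 (complexBetti.map g.hom.hom.hom 1 (c • ω)) (complexBetti.map h.hom.hom.hom 1 (c' • ω')) ∈ R
    rw [map_smul, map_smul, map_smul, map_smul, LinearMap.smul_apply]
    exact Submodule.smul_mem _ _ (Submodule.smul_mem _ _ (hpair g h))
  refine (Submodule.span_le.2 ?_) (AbelianVariety.oneOne_mem_span_cupProduct B b hb)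
  rintro _ ⟨x, y, hx, hy, rfl⟩
  exact hle (Submodule.apply_mem_map₂ _ (hB x hx) (AbelianVariety.hodgeZeroOne_mem_span_pullback E B hB y hy))

/-- **Slot structures satisfy the generation hypothesis**: if `H¹(B) = ∑ᵢ g_i^* H¹(E)` (`EllSlots E B g`),
then every `(1,0)`-class of `B` is a `ℂ`-combination of pull-backs `g^*w` of `(1,0)`-classes `w` of `E`
along homomorphisms `g : B → E` (split each `g_i^*x` by `x = x^{1,0} + x^{0,1}`; the `(0,1)`-part of the
resulting decomposition of a `(1,0)`-class is of both types, hence zero). Künneth in degree one with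
Hodge types, `H^{1,0}(Eⁿ) = ⊕ prᵢ^* H^{1,0}(E)`. [cite: LangeBirkenhake1992, Thm. 4.2.1]
[cite: VoisinHodgeI2002, §7.3.2 and §11.3.3] -/
theorem EllSlots.hodgeOneZero_mem_span_pullback {B : AbelianVariety ℂ} {n : ℕ} {g : Fin n → (B ⟶ E)}
    (hg : EllSlots E B g) (u : complexBetti B.X 1) (hu : IsOfHodgeType B.dim B.X 1 1 0 u) :
    u ∈ Submodule.span ℂ {y : complexBetti B.X 1 | ∃ (g : B ⟶ E) (w : complexBetti E.X 1),
        IsOfHodgeType E.dim E.X 1 1 0 w ∧ y = complexBetti.map g.hom.hom.hom 1 w} := by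
  have hBs : IsSmoothProjective B.dim B.X := Motives.AbelianVariety.isSmoothProjective_holds
  have hEs : IsSmoothProjective E.dim E.X := Motives.AbelianVariety.isSmoothProjective_holds
  set S10 := Submodule.span ℂ {y : complexBetti B.X 1 | ∃ (g : B ⟶ E) (w : complexBetti E.X 1),
        IsOfHodgeType E.dim E.X 1 1 0 w ∧ y = complexBetti.map g.hom.hom.hom 1 w} with hS10
  set S01 := Submodule.span ℂ {y : complexBetti B.X 1 | ∃ (g : B ⟶ E) (w : complexBetti E.X 1),
        IsOfHodgeType E.dim E.X 1 0 1 w ∧ y = complexBetti.map g.hom.hom.hom 1 w} with hS01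
  -- every class of `H¹(B)` lies in `S10 ⊔ S01`
  have hall : ∀ x : complexBetti B.X 1, x ∈ S10 ⊔ S01 := by
    intro x
    refine (Submodule.span_le.2 ?_) (hg.2 x)
    rintro _ ⟨⟨i, v⟩, rfl⟩
    obtain ⟨a₁, a₂, hav, ha₁, ha₂⟩ := exists_add_eq_of_isOfHodgeType_one hEs v
    change (complexBetti.map (g i).hom.hom.hom 1).hom v ∈ S10 ⊔ S01
    rw [← hav, map_add]
    exact Submodule.add_mem_sup (Submodule.subset_span ⟨g i, a₁, ha₁, rfl⟩)
      (Submodule.subset_span ⟨g i, a₂, ha₂, rfl⟩)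
  -- `S10 ⊆ H^{1,0}(B)`, `S01 ⊆ H^{0,1}(B)`
  have h10 : S10 ≤ hodgeOneZero hBs := by
    refine Submodule.span_le.2 ?_
    rintro _ ⟨g, w, hw, rfl⟩
    exact hw.map_of_isSmoothProjective hBs hEs _
  have h01 : S01 ≤ hodgeZeroOne hBs := by
    refine Submodule.span_le.2 ?_
    rintro _ ⟨g, w, hw, rfl⟩
    exact hw.map_of_isSmoothProjective hBs hEs _
  obtain ⟨s, hs, s', hs', hss'⟩ := Submodule.mem_sup.1 (hall u)
  -- `s' = u - s` is of type `(1,0)` and of type `(0,1)`, hence zero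
  have hs't : IsOfHodgeType B.dim B.X 1 1 0 s' := by
    have h : s' = u - s := by rw [← hss']; abel
    rw [h]
    exact hu.sub hBs (h10 hs)
  have hs'0 : s' = 0 := eq_zero_of_isOfHodgeType_one_zero_of_zero_one hBs hs't (h01 hs')
  rw [← hss', hs'0, add_zero]
  exact hs

end Cross

/-! ### §3 The second branch: `B` dominated by a curve which is not `HodgeEndTrivial` -/

section NotTrivial

variable {E : AbelianVariety ℂ} (hE : E.dim = 1) (hT : ¬ EllipticCurve.HodgeEndTrivial E)
include hE hT

/-- **`H^{1,1}(B) ⊆ D¹(B) ⊗ ℂ`** for every complex abelian variety `B` whose `(1,0)`-classes are combinations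
of pull-backs from one elliptic curve `E` with a NON-SCALAR Hodge endomorphism of `H¹(E)` (Type IV(1,1),
Hodge-theoretically). [cite: Gordon1997, §3 (proof of the Theorem, CM case)]
[cite: MoonenZarhin1999LowDim, (2.1) (g = 1)] -/
theorem EllipticCurve.oneOne_mem_span_rational_of_hodgeOneZero_mem_span_pullback_of_not_hodgeEndTrivial
    (B : AbelianVariety ℂ)
    (hB : ∀ u : complexBetti B.X 1, IsOfHodgeType B.dim B.X 1 1 0 u →
      u ∈ Submodule.span ℂ {y : complexBetti B.X 1 | ∃ (g : B ⟶ E) (w : complexBetti E.X 1),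
        IsOfHodgeType E.dim E.X 1 1 0 w ∧ y = complexBetti.map g.hom.hom.hom 1 w})
    (b : complexBetti B.X 2) (hb : IsOfHodgeType B.dim B.X 2 1 1 b) :
    b ∈ Submodule.span ℂ {b : complexBetti B.X 2 | IsRationalClass b ∧ IsOfHodgeType B.dim B.X 2 1 1 b} := by
  obtain ⟨ω, hω, hω0, hgen⟩ := EllipticCurve.exists_hodgeOneZero_generator hE
  exact EllipticCurve.oneOne_mem_span_rational_of_cross hgen
    (EllipticCurve.cross_mem_span_rational_oneOne_of_not_hodgeEndTrivial hE hT hω hω0 hgen).1 B hB b hb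

/-- **`Bᵖ(B) ⊆ Dᵖ(B) ⊗ ℂ` for every `p`** for such `B` (Part 1 of `MaximalPicardNumberHodgeClasses`).
[cite: vanGeemen1994HodgeAV, Thm. 4.3] [cite: Gordon1997, §3] -/
theorem EllipticCurve.hodgeClasses_divisorial_of_hodgeOneZero_mem_span_pullback_of_not_hodgeEndTrivial
    (B : AbelianVariety ℂ)
    (hB : ∀ u : complexBetti B.X 1, IsOfHodgeType B.dim B.X 1 1 0 u →
      u ∈ Submodule.span ℂ {y : complexBetti B.X 1 | ∃ (g : B ⟶ E) (w : complexBetti E.X 1),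
        IsOfHodgeType E.dim E.X 1 1 0 w ∧ y = complexBetti.map g.hom.hom.hom 1 w})
    (p : ℕ) (c : complexBetti B.X (2 * p)) (hc : IsRationalClass c) (hpp : IsOfHodgeType B.dim B.X (2 * p) p p c) :
    c ∈ divisorClassesSpan B.X B.dim p :=
  AbelianVariety.hodgeClasses_divisorial_of_oneOne B
    (EllipticCurve.oneOne_mem_span_rational_of_hodgeOneZero_mem_span_pullback_of_not_hodgeEndTrivial hE hT B hB)
    p c hc hpp

/-- **The Hodge conjecture for such `B`**, in the summit layer's spelling `HodgeConjectureFor B.dim B.X`.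
[cite: vanGeemen1994HodgeAV, Thm. 4.3] [cite: Gordon1997, §3] [cite: Deligne2000, §1] -/
theorem EllipticCurve.hodgeConjectureFor_of_hodgeOneZero_mem_span_pullback_of_not_hodgeEndTrivial
    (B : AbelianVariety ℂ)
    (hB : ∀ u : complexBetti B.X 1, IsOfHodgeType B.dim B.X 1 1 0 u →
      u ∈ Submodule.span ℂ {y : complexBetti B.X 1 | ∃ (g : B ⟶ E) (w : complexBetti E.X 1),
        IsOfHodgeType E.dim E.X 1 1 0 w ∧ y = complexBetti.map g.hom.hom.hom 1 w}) :
    HodgeConjectureFor B.dim B.X :=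
  AbelianVariety.hodgeConjectureFor_of_oneOne B
    (EllipticCurve.oneOne_mem_span_rational_of_hodgeOneZero_mem_span_pullback_of_not_hodgeEndTrivial hE hT B hB)

end NotTrivial

/-! ### §4 Assembly: every complex elliptic curve -/

section Assembly

variable {E B : AbelianVariety ℂ} {n : ℕ} {g : Fin n → (B ⟶ E)} (hE : E.dim = 1)
include hE

/-- **`Bᵖ(B) ⊆ Dᵖ(B) ⊗ ℂ` for every complex abelian variety with an `E`-slot structure, `E` ANY complex
elliptic curve**: every rational class of Hodge type `(p, p)` in `H²ᵖ(B(ℂ); ℂ)` lies in the `ℂ`-span of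
the products of `p` rational `(1,1)`-classes. By the dichotomy: `HodgeEndTrivial E` —
`EllSlots.hodgeClasses_divisorial` (the `𝔰𝔩₂` invariant theory of `NonCMEllipticCurvePowersHodgeClasses`);
otherwise the cross-class mechanism (`EllSlots.hodgeOneZero_mem_span_pullback` and §3). Van Geemen 4.3
(Tate): "`Bᵖ(X) = Dᵖ(X)` for all `p`"; Gordon §3: "In [B.80] Murasaki showed the `Hdgᵖ(Eⁿ) = Divᵖ(Eⁿ)`
for all `p`". [cite: vanGeemen1994HodgeAV, Thm. 4.3] [cite: Gordon1997, §3 (Tate; Murasaki [B.80])]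
[cite: MoonenZarhin1999LowDim, (2.1) and Cor. 3.9] -/
theorem EllSlots.hodgeClasses_divisorial' (hg : EllSlots E B g) (p : ℕ) (c : complexBetti B.X (2 * p))
    (hcQ : IsRationalClass c) (hc : IsOfHodgeType B.dim B.X (2 * p) p p c) :
    c ∈ divisorClassesSpan B.X B.dim p := by
  by_cases hT : EllipticCurve.HodgeEndTrivial E
  · exact hg.hodgeClasses_divisorial hE hT p c hcQ hc
  · exact EllipticCurve.hodgeClasses_divisorial_of_hodgeOneZero_mem_span_pullback_of_not_hodgeEndTrivial
      hE hT B hg.hodgeOneZero_mem_span_pullback p c hcQ hc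

/-- **The Hodge classes of such a `B` are algebraic in every codimension** (`Dᵖ ⊗ ℂ ⊆ Nᵖ H²ᵖ`: products of
divisor classes are algebraic, Lefschetz `(1,1)` = the tree's `lefschetzOneOne_rational_holds`).
[cite: vanGeemen1994HodgeAV, Thm. 4.3 and §2.4] [cite: Gordon1997, §3] -/
theorem EllSlots.hodgeClasses_algebraic' (hg : EllSlots E B g) (p : ℕ) (c : complexBetti B.X (2 * p))
    (hcQ : IsRationalClass c) (hc : IsOfHodgeType B.dim B.X (2 * p) p p c) :
    c ∈ algebraicClasses B.X p :=
  AbelianVariety.divisorClassesSpan_le_algebraicClasses B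
    (fun b hb hb' ↦ lefschetzOneOne_rational_holds
      (Motives.AbelianVariety.isSmoothProjective_holds (A := B)) b hb hb') p
    (hg.hodgeClasses_divisorial' hE p c hcQ hc)

/-- **The Hodge conjecture for every complex abelian variety with an `E`-slot structure, `E` ANY complex
elliptic curve** (all products of copies of `E` in any bracketing), UNCONDITIONAL.
[cite: vanGeemen1994HodgeAV, Thm. 4.3] [cite: Gordon1997, §3] [cite: Deligne2000, §1] -/
theorem EllSlots.hodgeConjectureFor' (hg : EllSlots E B g) : HodgeConjectureFor B.dim B.X :=
  ⟨nonempty_hodgeModel_holds (Motives.AbelianVariety.isSmoothProjective_holds (A := B)),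
    fun p c hc hpp ↦ hg.hodgeClasses_algebraic' hE p c hc hpp⟩

/-- **Tate–Murasaki, `Bᵖ(Eᴺ⁺¹) = Dᵖ(Eᴺ⁺¹)` for EVERY complex elliptic curve `E`**, all `p` and `N`, on the
bracketing `E.powSucc N = (⋯(E × E) × ⋯) × E`: every rational `(p,p)`-class is a `ℂ`-combination of
`p`-fold products of divisor classes. [cite: vanGeemen1994HodgeAV, Thm. 4.3]
[cite: Gordon1997, §3 (Tate; Murasaki [B.80])] [cite: MoonenZarhin1999LowDim, Cor. 3.9 and (1.8)] -/
theorem EllipticCurve.hodgeClasses_divisorial_powSucc (N p : ℕ) (c : complexBetti (E.powSucc N).X (2 * p))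
    (hcQ : IsRationalClass c) (hc : IsOfHodgeType (E.powSucc N).dim (E.powSucc N).X (2 * p) p p c) :
    c ∈ divisorClassesSpan (E.powSucc N).X (E.powSucc N).dim p :=
  (EllSlots.powSucc hE N).hodgeClasses_divisorial' hE p c hcQ hc

/-- **The Hodge classes of every power `Eᴺ⁺¹` of every complex elliptic curve are algebraic, in every
codimension.** [cite: vanGeemen1994HodgeAV, Thm. 4.3] [cite: Gordon1997, §3] -/
theorem EllipticCurve.hodgeClasses_algebraic_powSucc (N p : ℕ) (c : complexBetti (E.powSucc N).X (2 * p))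
    (hcQ : IsRationalClass c) (hc : IsOfHodgeType (E.powSucc N).dim (E.powSucc N).X (2 * p) p p c) :
    c ∈ algebraicClasses (E.powSucc N).X p :=
  (EllSlots.powSucc hE N).hodgeClasses_algebraic' hE p c hcQ hc

/-- **The Hodge conjecture for `Eᴺ⁺¹`, `E` ANY complex elliptic curve, in the summit layer's spelling
`HodgeConjectureFor (Eᴺ⁺¹).dim (Eᴺ⁺¹).X`** — UNCONDITIONAL (Tate 1965; Murasaki; van Geemen 4.3;
Moonen–Zarhin (2.1): Type I(1) by `EllipticCurve.hodgeConjectureFor_powSucc_of_hodgeEndTrivial`, Type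
IV(1,1) Hodge-theoretically by §3). For `N ≥ 3` these are abelian varieties of dimension `≥ 4`.
[cite: vanGeemen1994HodgeAV, Thm. 4.3] [cite: Gordon1997, §3] [cite: MoonenZarhin1999LowDim, (2.1) and Cor. 3.9]
[cite: Deligne2000, §1] -/
theorem EllipticCurve.hodgeConjectureFor_powSucc (N : ℕ) :
    HodgeConjectureFor (E.powSucc N).dim (E.powSucc N).X :=
  (EllSlots.powSucc hE N).hodgeConjectureFor' hE

/-- **The Hodge conjecture for `Eᵃ⁺¹ × Eᵇ⁺¹`**, `E` any complex elliptic curve, UNCONDITIONAL.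
[cite: vanGeemen1994HodgeAV, Thm. 4.3] [cite: Gordon1997, §3] -/
theorem EllipticCurve.hodgeConjectureFor_powSucc_prod_powSucc (a b : ℕ) :
    HodgeConjectureFor ((E.powSucc a).prod (E.powSucc b)).dim ((E.powSucc a).prod (E.powSucc b)).X :=
  ((EllSlots.powSucc hE a).prod (EllSlots.powSucc hE b)).hodgeConjectureFor' hE

/-- **Van Geemen 1994, Theorem 4.3 (Tate) up to isogeny, one curve: the Hodge conjecture for every complex
abelian variety isogenous to a power `Eᴺ⁺¹` of a complex elliptic curve** — by Lemma 3.7 (isogeny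
invariance, the tree's theorem `HodgeConjectureFor.of_isIsogenous`). UNCONDITIONAL, no hypothesis on `E`.
[cite: vanGeemen1994HodgeAV, Lemma 3.7 and Thm. 4.3] [cite: Gordon1997, §3] -/
theorem EllipticCurve.hodgeConjectureFor_of_isIsogenous_powSucc (N : ℕ) {A : AbelianVariety ℂ}
    (hA : A.IsIsogenous (E.powSucc N)) : HodgeConjectureFor A.dim A.X :=
  HodgeConjectureFor.of_isIsogenous hA (EllipticCurve.hodgeConjectureFor_powSucc hE N)

/-- The same with the isogeny in the other direction (`Eᴺ⁺¹ → A`). [cite: vanGeemen1994HodgeAV, §3.5–3.7] -/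
theorem EllipticCurve.hodgeConjectureFor_of_isIsogenous_powSucc' (N : ℕ) {A : AbelianVariety ℂ}
    (hA : (E.powSucc N).IsIsogenous A) : HodgeConjectureFor A.dim A.X :=
  HodgeConjectureFor.of_isIsogenous' hA (EllipticCurve.hodgeConjectureFor_powSucc hE N)

/-- **The Hodge conjecture for every complex abelian variety isogenous to one with an `E`-slot structure**
(van Geemen's "isogeneous to a product of elliptic curves", one curve `E`, no hypothesis on `E`).
[cite: vanGeemen1994HodgeAV, Lemma 3.7 and Thm. 4.3] -/
theorem EllSlots.hodgeConjectureFor_of_isIsogenous' (hg : EllSlots E B g) {A : AbelianVariety ℂ}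
    (hA : A.IsIsogenous B) : HodgeConjectureFor A.dim A.X :=
  HodgeConjectureFor.of_isIsogenous hA (hg.hodgeConjectureFor' hE)

omit hE in
/-- ON-PATH bookkeeping: the conclusion of `EllipticCurve.hodgeConjectureFor_powSucc` is, proof or no
proof, a CASE of the Hodge conjecture for smooth projective complex varieties (its instance on `Eᴺ⁺¹`);
nothing here is summit progress beyond that instance. [cite: Deligne2000, §1] -/
theorem EllipticCurve.hodgeConjectureFor_powSucc_of_forall
    (h : ∀ ⦃m : ℕ⦄ ⦃Y : Motives.SchemeOver ℂ⦄, Motives.IsSmoothProjective m Y → HodgeConjectureFor m Y)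
    (N : ℕ) : HodgeConjectureFor (E.powSucc N).dim (E.powSucc N).X :=
  h (Motives.AbelianVariety.isSmoothProjective_holds (A := E.powSucc N))

end Assembly

end HodgeTheory

end Literature.AlgebraicGeometry.HodgeTheory
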